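import Summits.QuantumFields.BalabanUV.Beta.GAN24.WoodburyFibreProjectorDeriv
import Summits.QuantumFields.BalabanUV.Beta.GAN24.WoodburyFibreProjectorZdDecay

/-!
# Beta / GAN24 / WoodburyFibreProjectorDerivZd — census row V12, `ℤ^{d+1}` half: the DERIVATIVE entries of `P = δ − R(1)` for an2's
`R(1) = L·Sb·L` — `N·D_μP`, `N·P D_ν*`, `N²·D_μ P D_ν*` are `O(N^{−(d+1)})·e^{−δ·(block distance)}` UNIFORMLY ALONG THE SCALES `N = L^k`

Cell `pub-balaban`, β sub-cell, BINDER ROW **G-an2-4 ∕ (CONV-C)** («NOT IN PRINT; our proof attempt»), prover part **P3 = WOODBURY-FIBRE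
reduction** (lineage `b2b-balaban-gan24-p3`, gen 7).  HONEST FRAMING (verbatim): discharging `BetaPertH` makes Bałaban's UV stability
UNCONDITIONAL — a real constructive-QFT result; it is NOT the continuum limit and NOT the Clay problem.  HONEST DEPENDENCY: continuum YM
on T⁴ ⇐ BetaPertH ∧ nine spine estimates (0/9 proved); BetaPertH ⇐ (D1) ∧ (D4) ∧ CAP+tail; G-an2-4 gates asym, D1 and NE2/3/4.
`[folklore]`; 0 sorry; an2's files imported and used BY NAME; nothing printed and nothing programme-internal is a hypothesis.
NOT (CONV-C), NOT «G-an2-4 closed», NOT `BetaPertH`.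

STATEMENT (`Pz_deriv_decay_uniform`), with `Pz N x x′ := δ_{xx′} − Rb N x x′` (`Rb = (L⊗L)Sb`, `WoodburyFibreProjectorZd`): for every `d` and
`L = ℓ+1 ≥ 2` there are `δ, C > 0` such that for EVERY `k ≥ 1`, `N = L^k`, all axes `μ, ν` and all `x, x′ ∈ ℤ^{d+1}`:
`|N·(Pz(x+e_μ, x′) − Pz(x, x′))|`, `|N·(Pz(x, x′+e_ν) − Pz(x, x′))|`, `|N²·(Pz(x+e_μ, x′+e_ν) − Pz(x+e_μ, x′) − Pz(x, x′+e_ν) + Pz(x, x′))|`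
are all `≤ C·N^{−(d+1)}·e^{−δ|quo_N x − quo_N x′|_∞}` — the `U = 1`, one-domain `DP`, `PD*`, `DPD*` entries of [B9] p. 399 (3.49) (journal render
re-read by this seat; LOCATOR, not a hypothesis): «[|P(x,x′)|, |(DP)_μ(x,x′)|, |(PD*)_ν(x,x′)|, |(DPD*)_{μν}(x,x′)|] ≤ O(1)[1, (L^jη)^{−1}, (L^jη)^{−1},
(L^jη)^{−2}](L^{j′}η)^{−d}e^{−(1/2)δ₀d(y,y′)}».  PROOF: the box complements `(1 − projR)` on gen 6's re-centred Neumann boxes converge pointwise to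
`Pz` along the subsequence of `WoodburyFibreProjectorZdDecay.exists_subseq_tendsto_Sb` (`exists_subseq_tendsto_Pz`, via `lap2_KR_eq`); their scaled
differences are the entries of `shiftDiff`∕`shiftDiffCol` of `WoodburyFibreProjectorDeriv`, bounded uniformly by `one_sub_projR_deriv_decay`; the
bound passes to the limit.
-/

namespace Summit.QuantumFields.BalabanUV.Beta.GAN24.WoodburyFibreProjectorDerivZd

open Filter Topology Finset Matrix
open Literature.MathematicalPhysics.QuantumFieldTheory
open Literature.MathematicalPhysics.QuantumFieldTheory.Balaban1983to89
open B4ContourShift (supNorm supNorm_nonneg)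
open B4Reflection242 (boxDom mem_boxDom blk nbrs mem_nbrs supNorm_le_of_forall)
open B4BoxCov237 (rho)
open B5Decay126 (PosDecay)
open Beta.AffineAveraging (dz codiff₁)
open Beta.BiLaplaceBlockKKT (Sb)
open LatticeForm (quo)
open WoodburyFibreGaugeCubeDecay (CubeDecay)
open WoodburyFibreBoxQGQ (fineN blkBox blkBox_val)
open WoodburyFibreLandauBox (landau_box_cubeDecay_indB)
open WoodburyFibreLandauLimit
open WoodburyFibreLandauZd (KR quo_eq_blk)
open WoodburyFibreProjector (projR)
open WoodburyFibreProjectorZd (Rb)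
open WoodburyFibreProjectorZdDecay (exists_subseq_tendsto_Sb interior_of_two_nbhd_shift lap2_KR_eq)
open WoodburyFibreProjectorDeriv

noncomputable section

variable {d : ℕ}

/-! ## §1 The complement kernel on `ℤ^{d+1}` and the box complements converging to it -/

/-- `Pz N x x′ := δ_{xx′} − Rb N x x′`, the complement `P = 1 − R(1)` of an2's projection on `ℤ^{d+1}`. [folklore] -/
def Pz (n : ℕ) [NeZero n] (x x' : Fin (d + 1) → ℤ) : ℝ := (if x = x' then 1 else 0) - Rb n x x'

/-- the entry of the box complement `1 − projR n (cubeM d R)` at the shifted points (`0` if either point is outside). [folklore] -/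
def boxP (n R : ℕ) (x x' : Fin (d + 1) → ℤ) : ℝ :=
  if h : x + shiftF d n R ∈ boxDom (fineN n (cubeM d R)) ∧ x' + shiftF d n R ∈ boxDom (fineN n (cubeM d R)) then
    (1 - projR n (cubeM d R)) ⟨x + shiftF d n R, h.1⟩ ⟨x' + shiftF d n R, h.2⟩
  else 0

/-- reading of `boxP` inside. [folklore] -/
theorem boxP_of_mem {n R : ℕ} {x x' : Fin (d + 1) → ℤ} (hx : x + shiftF d n R ∈ boxDom (fineN n (cubeM d R)))
    (hx' : x' + shiftF d n R ∈ boxDom (fineN n (cubeM d R))) :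
    boxP n R x x' = (1 - projR n (cubeM d R)) ⟨x + shiftF d n R, hx⟩ ⟨x' + shiftF d n R, hx'⟩ := by
  simp only [boxP, dif_pos (And.intro hx hx')]

/-- **the box complements converge to `Pz` pointwise along gen 6's subsequence**. [folklore] -/
theorem exists_subseq_tendsto_Pz {n : ℕ} [NeZero n] (hn : 1 ≤ n) {C δ : ℝ} (hδ : 0 ≤ δ)
    (hbox : ∀ R, 1 ≤ R → CubeDecay (rho (cubeM d R)) (blkBox hn (cubeM d R)) id (landauCov n (cubeM d R)) C δ) :
    ∃ φ : ℕ → ℕ, StrictMono φ ∧ ∀ x x' : Fin (d + 1) → ℤ, Tendsto (fun R => boxP n (φ R + 1) x x') atTop (𝓝 (Pz n x x')) := by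
  obtain ⟨φ, hφ, hlim⟩ := exists_subseq_tendsto_Sb hn hδ hbox
  refine ⟨φ, hφ, fun x x' => ?_⟩
  have hφge : ∀ R, R ≤ φ R := fun R => hφ.id_le R
  have hconv : Tendsto (fun R => (if x = x' then (1 : ℝ) else 0)
      - codiff₁ (dz (fun z => codiff₁ (dz (fun w => KR n (φ R + 1) z w)) x')) x) atTop (𝓝 (Pz n x x')) :=
    tendsto_const_nhds.sub (tendsto_lap (fun z => tendsto_lap (fun w => hlim z w) x') x)
  obtain ⟨R₁, hR₁⟩ := eventually_two_nbhd (d := d) hn x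
  obtain ⟨R₂, hR₂⟩ := eventually_two_nbhd (d := d) hn x'
  refine hconv.congr' (Filter.eventually_atTop.2 ⟨R₁ + R₂, fun R hR => ?_⟩)
  dsimp only
  have hge := hφge R
  obtain ⟨hxm, hxn⟩ := interior_of_two_nbhd_shift (hR₁ (φ R + 1) (by omega))
  obtain ⟨hx'm, hx'n⟩ := interior_of_two_nbhd_shift (hR₂ (φ R + 1) (by omega))
  rw [lap2_KR_eq hn hxm hxn hx'm hx'n, boxP_of_mem hxm hx'm, Matrix.sub_apply, Matrix.one_apply]
  have hiff : ((⟨x + shiftF d n (φ R + 1), hxm⟩ : ↥(boxDom (fineN n (cubeM d (φ R + 1))))) = ⟨x' + shiftF d n (φ R + 1), hx'm⟩)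
      ↔ x = x' := by
    rw [Subtype.ext_iff]; exact add_left_inj _
  by_cases hxx : x = x'
  · rw [if_pos hxx, if_pos (hiff.2 hxx)]
  · rw [if_neg hxx, if_neg (fun e => hxx (hiff.1 e))]

/-! ## §2 The derivative entries pass to the limit -/

/-- shifting commutes with adding a unit vector. [folklore] -/
theorem add_single_add_shiftF (n R : ℕ) (x : Fin (d + 1) → ℤ) (μ : Fin (d + 1)) :
    x + Pi.single μ 1 + shiftF d n R = (x + shiftF d n R) + Pi.single μ 1 := add_right_comm _ _ _

/-- **ONE SCALE**: uniform bounds on the scaled differences of the box complements pass to `Pz`. [folklore] -/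
theorem Pz_deriv_of_box {n : ℕ} [NeZero n] (hn : 1 ≤ n) {C₀ δ₀ C δ : ℝ} (hδ₀ : 0 ≤ δ₀)
    (hbox : ∀ R, 1 ≤ R → CubeDecay (rho (cubeM d R)) (blkBox hn (cubeM d R)) id (landauCov n (cubeM d R)) C₀ δ₀)
    (hD : ∀ R, 1 ≤ R → ∀ μ ν : Fin (d + 1),
      PosDecay (rho (cubeM d R)) (id ∘ blkBox hn (cubeM d R)) (id ∘ blkBox hn (cubeM d R))
          (shiftDiff μ (n : ℝ) (1 - projR n (cubeM d R))) C δ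
        ∧ PosDecay (rho (cubeM d R)) (id ∘ blkBox hn (cubeM d R)) (id ∘ blkBox hn (cubeM d R))
          (shiftDiffCol ν (n : ℝ) (1 - projR n (cubeM d R))) C δ
        ∧ PosDecay (rho (cubeM d R)) (id ∘ blkBox hn (cubeM d R)) (id ∘ blkBox hn (cubeM d R))
          (shiftDiff μ (n : ℝ) (shiftDiffCol ν (n : ℝ) (1 - projR n (cubeM d R)))) C δ)
    (μ ν : Fin (d + 1)) (x x' : Fin (d + 1) → ℤ) :
    |(n : ℝ) * (Pz n (x + Pi.single μ 1) x' - Pz n x x')| ≤ C * Real.exp (-(δ * supNorm (blk n x - blk n x')))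
    ∧ |(n : ℝ) * (Pz n x (x' + Pi.single ν 1) - Pz n x x')| ≤ C * Real.exp (-(δ * supNorm (blk n x - blk n x')))
    ∧ |(n : ℝ) * (n : ℝ) * (Pz n (x + Pi.single μ 1) (x' + Pi.single ν 1) - Pz n (x + Pi.single μ 1) x'
        - Pz n x (x' + Pi.single ν 1) + Pz n x x')| ≤ C * Real.exp (-(δ * supNorm (blk n x - blk n x'))) := by
  obtain ⟨φ, hφ, hlim⟩ := exists_subseq_tendsto_Pz hn hδ₀ hbox
  have hφge : ∀ R, R ≤ φ R := fun R => hφ.id_le R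
  obtain ⟨R₁, hR₁⟩ := eventually_two_nbhd (d := d) hn x
  obtain ⟨R₂, hR₂⟩ := eventually_two_nbhd (d := d) hn x'
  -- interiority of the four points, eventually
  have hmem : ∀ R, R₁ + R₂ ≤ R →
      (x + shiftF d n (φ R + 1) ∈ boxDom (fineN n (cubeM d (φ R + 1))))
      ∧ (x + Pi.single μ 1 + shiftF d n (φ R + 1) ∈ boxDom (fineN n (cubeM d (φ R + 1))))
      ∧ (x' + shiftF d n (φ R + 1) ∈ boxDom (fineN n (cubeM d (φ R + 1))))
      ∧ (x' + Pi.single ν 1 + shiftF d n (φ R + 1) ∈ boxDom (fineN n (cubeM d (φ R + 1)))) := by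
    intro R hR
    have hge := hφge R
    obtain ⟨hxm, hxn⟩ := interior_of_two_nbhd_shift (hR₁ (φ R + 1) (by omega))
    obtain ⟨hx'm, hx'n⟩ := interior_of_two_nbhd_shift (hR₂ (φ R + 1) (by omega))
    exact ⟨hxm, hxn _ (mem_nbrs.2 ⟨μ, Or.inl rfl⟩), hx'm, hx'n _ (mem_nbrs.2 ⟨ν, Or.inl rfl⟩)⟩
  -- the distance at the shifted points
  have hdist : ∀ R (hx : x + shiftF d n R ∈ boxDom (fineN n (cubeM d R))) (hx' : x' + shiftF d n R ∈ boxDom (fineN n (cubeM d R))),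
      rho (cubeM d R) ((id ∘ blkBox hn (cubeM d R)) ⟨x + shiftF d n R, hx⟩) ((id ∘ blkBox hn (cubeM d R)) ⟨x' + shiftF d n R, hx'⟩)
        = supNorm (blk n x - blk n x') := by
    intro R hx hx'
    simp only [Function.comp_apply, id, rho, blkBox_val, blk_add_shiftF hn, add_sub_add_right_eq_sub]
  refine ⟨?_, ?_, ?_⟩
  · have hconv : Tendsto (fun R => (n : ℝ) * (boxP n (φ R + 1) (x + Pi.single μ 1) x' - boxP n (φ R + 1) x x')) atTop
        (𝓝 ((n : ℝ) * (Pz n (x + Pi.single μ 1) x' - Pz n x x'))) := ((hlim _ _).sub (hlim _ _)).const_mul _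
    refine le_of_tendsto hconv.abs (Filter.eventually_atTop.2 ⟨R₁ + R₂, fun R hR => ?_⟩)
    obtain ⟨hxm, hxem, hx'm, -⟩ := hmem R hR
    have hxe' : (x + shiftF d n (φ R + 1)) + Pi.single μ 1 ∈ boxDom (fineN n (cubeM d (φ R + 1))) := by
      rwa [← add_single_add_shiftF]
    have h := ((hD (φ R + 1) (by omega) μ ν).1).2 ⟨x + shiftF d n (φ R + 1), hxm⟩ ⟨x' + shiftF d n (φ R + 1), hx'm⟩
    rw [hdist, shiftDiff_apply_of_mem μ _ _ _ hxe'] at h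
    rw [boxP_of_mem hxem hx'm, boxP_of_mem hxm hx'm]
    have hpt : (⟨x + Pi.single μ 1 + shiftF d n (φ R + 1), hxem⟩ : ↥(boxDom (fineN n (cubeM d (φ R + 1)))))
        = ⟨(x + shiftF d n (φ R + 1)) + Pi.single μ 1, hxe'⟩ := Subtype.ext (add_single_add_shiftF _ _ _ _)
    rw [hpt]
    exact h
  · have hconv : Tendsto (fun R => (n : ℝ) * (boxP n (φ R + 1) x (x' + Pi.single ν 1) - boxP n (φ R + 1) x x')) atTop
        (𝓝 ((n : ℝ) * (Pz n x (x' + Pi.single ν 1) - Pz n x x'))) := ((hlim _ _).sub (hlim _ _)).const_mul _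
    refine le_of_tendsto hconv.abs (Filter.eventually_atTop.2 ⟨R₁ + R₂, fun R hR => ?_⟩)
    obtain ⟨hxm, -, hx'm, hx'em⟩ := hmem R hR
    have hx'e' : (x' + shiftF d n (φ R + 1)) + Pi.single ν 1 ∈ boxDom (fineN n (cubeM d (φ R + 1))) := by
      rwa [← add_single_add_shiftF]
    have h := ((hD (φ R + 1) (by omega) μ ν).2.1).2 ⟨x + shiftF d n (φ R + 1), hxm⟩ ⟨x' + shiftF d n (φ R + 1), hx'm⟩
    rw [hdist, shiftDiffCol_apply_of_mem ν _ _ _ _ hx'e'] at h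
    rw [boxP_of_mem hxm hx'em, boxP_of_mem hxm hx'm]
    have hpt : (⟨x' + Pi.single ν 1 + shiftF d n (φ R + 1), hx'em⟩ : ↥(boxDom (fineN n (cubeM d (φ R + 1)))))
        = ⟨(x' + shiftF d n (φ R + 1)) + Pi.single ν 1, hx'e'⟩ := Subtype.ext (add_single_add_shiftF _ _ _ _)
    rw [hpt]
    exact h
  · have hconv : Tendsto (fun R => (n : ℝ) * (n : ℝ) * (boxP n (φ R + 1) (x + Pi.single μ 1) (x' + Pi.single ν 1)
        - boxP n (φ R + 1) (x + Pi.single μ 1) x' - boxP n (φ R + 1) x (x' + Pi.single ν 1) + boxP n (φ R + 1) x x')) atTop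
        (𝓝 ((n : ℝ) * (n : ℝ) * (Pz n (x + Pi.single μ 1) (x' + Pi.single ν 1) - Pz n (x + Pi.single μ 1) x'
          - Pz n x (x' + Pi.single ν 1) + Pz n x x'))) :=
      ((((hlim _ _).sub (hlim _ _)).sub (hlim _ _)).add (hlim _ _)).const_mul _
    refine le_of_tendsto hconv.abs (Filter.eventually_atTop.2 ⟨R₁ + R₂, fun R hR => ?_⟩)
    obtain ⟨hxm, hxem, hx'm, hx'em⟩ := hmem R hR
    have hxe' : (x + shiftF d n (φ R + 1)) + Pi.single μ 1 ∈ boxDom (fineN n (cubeM d (φ R + 1))) := by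
      rwa [← add_single_add_shiftF]
    have hx'e' : (x' + shiftF d n (φ R + 1)) + Pi.single ν 1 ∈ boxDom (fineN n (cubeM d (φ R + 1))) := by
      rwa [← add_single_add_shiftF]
    have h := ((hD (φ R + 1) (by omega) μ ν).2.2).2 ⟨x + shiftF d n (φ R + 1), hxm⟩ ⟨x' + shiftF d n (φ R + 1), hx'm⟩
    rw [hdist, shiftDiff_shiftDiffCol_apply_of_mem μ ν _ _ _ _ _ hxe' hx'e'] at h
    rw [boxP_of_mem hxem hx'em, boxP_of_mem hxem hx'm, boxP_of_mem hxm hx'em, boxP_of_mem hxm hx'm]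
    have hpt : (⟨x + Pi.single μ 1 + shiftF d n (φ R + 1), hxem⟩ : ↥(boxDom (fineN n (cubeM d (φ R + 1)))))
        = ⟨(x + shiftF d n (φ R + 1)) + Pi.single μ 1, hxe'⟩ := Subtype.ext (add_single_add_shiftF _ _ _ _)
    have hpt' : (⟨x' + Pi.single ν 1 + shiftF d n (φ R + 1), hx'em⟩ : ↥(boxDom (fineN n (cubeM d (φ R + 1)))))
        = ⟨(x' + shiftF d n (φ R + 1)) + Pi.single ν 1, hx'e'⟩ := Subtype.ext (add_single_add_shiftF _ _ _ _)
    rw [hpt, hpt']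
    exact h

/-- **THE DERIVATIVE ENTRIES OF `P = δ − R(1)` ON `ℤ^{d+1}`, UNIFORMLY ALONG THE SCALES** (census row V12, `ℤ^{d+1}` half): see the module
docstring; `(δ, C)` are those of `WoodburyFibreProjectorDeriv.one_sub_projR_deriv_decay`. [folklore] -/
theorem Pz_deriv_decay_uniform (d ℓ : ℕ) (hℓ : 1 ≤ ℓ) :
    ∃ δ C : ℝ, 0 < δ ∧ 0 < C ∧ ∀ (k : ℕ), 1 ≤ k → ∀ (μ ν : Fin (d + 1)) (x x' : Fin (d + 1) → ℤ),
      |((((ℓ + 1) ^ k : ℕ)) : ℝ) * (@Pz d ((ℓ + 1) ^ k) ⟨Nat.pos_iff_ne_zero.1 (Nat.one_le_pow k (ℓ + 1) (Nat.succ_pos ℓ))⟩ (x + Pi.single μ 1) x'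
          - @Pz d ((ℓ + 1) ^ k) ⟨Nat.pos_iff_ne_zero.1 (Nat.one_le_pow k (ℓ + 1) (Nat.succ_pos ℓ))⟩ x x')|
        ≤ C * ((((ℓ + 1) ^ k : ℕ) : ℝ) ^ (d + 1))⁻¹ * Real.exp (-(δ * supNorm (quo ((ℓ + 1) ^ k) x - quo ((ℓ + 1) ^ k) x')))
      ∧ |((((ℓ + 1) ^ k : ℕ)) : ℝ) * (@Pz d ((ℓ + 1) ^ k) ⟨Nat.pos_iff_ne_zero.1 (Nat.one_le_pow k (ℓ + 1) (Nat.succ_pos ℓ))⟩ x (x' + Pi.single ν 1)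
          - @Pz d ((ℓ + 1) ^ k) ⟨Nat.pos_iff_ne_zero.1 (Nat.one_le_pow k (ℓ + 1) (Nat.succ_pos ℓ))⟩ x x')|
        ≤ C * ((((ℓ + 1) ^ k : ℕ) : ℝ) ^ (d + 1))⁻¹ * Real.exp (-(δ * supNorm (quo ((ℓ + 1) ^ k) x - quo ((ℓ + 1) ^ k) x')))
      ∧ |((((ℓ + 1) ^ k : ℕ)) : ℝ) * ((((ℓ + 1) ^ k : ℕ)) : ℝ)
          * (@Pz d ((ℓ + 1) ^ k) ⟨Nat.pos_iff_ne_zero.1 (Nat.one_le_pow k (ℓ + 1) (Nat.succ_pos ℓ))⟩ (x + Pi.single μ 1) (x' + Pi.single ν 1)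
            - @Pz d ((ℓ + 1) ^ k) ⟨Nat.pos_iff_ne_zero.1 (Nat.one_le_pow k (ℓ + 1) (Nat.succ_pos ℓ))⟩ (x + Pi.single μ 1) x'
            - @Pz d ((ℓ + 1) ^ k) ⟨Nat.pos_iff_ne_zero.1 (Nat.one_le_pow k (ℓ + 1) (Nat.succ_pos ℓ))⟩ x (x' + Pi.single ν 1)
            + @Pz d ((ℓ + 1) ^ k) ⟨Nat.pos_iff_ne_zero.1 (Nat.one_le_pow k (ℓ + 1) (Nat.succ_pos ℓ))⟩ x x')|
        ≤ C * ((((ℓ + 1) ^ k : ℕ) : ℝ) ^ (d + 1))⁻¹ * Real.exp (-(δ * supNorm (quo ((ℓ + 1) ^ k) x - quo ((ℓ + 1) ^ k) x'))) := by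
  obtain ⟨δ₀, C₀, hδ₀, hC₀, h₀⟩ := landau_box_cubeDecay_indB d ℓ hℓ (m2plus := 0) le_rfl
  obtain ⟨δ, C, hδ, hC, h⟩ := one_sub_projR_deriv_decay d ℓ hℓ
  refine ⟨δ, C, hδ, hC, fun k hk μ ν x x' => ?_⟩
  have hn : 1 ≤ (ℓ + 1) ^ k := Nat.one_le_pow k (ℓ + 1) (Nat.succ_pos ℓ)
  haveI : NeZero ((ℓ + 1) ^ k) := ⟨Nat.pos_iff_ne_zero.1 hn⟩
  have hbox : ∀ R, 1 ≤ R →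
      CubeDecay (rho (cubeM d R)) (blkBox hn (cubeM d R)) id (landauCov ((ℓ + 1) ^ k) (cubeM d R)) C₀ δ₀ := fun R hR =>
    h₀ k hk 0 le_rfl le_rfl (cubeM d R) (fun i => by simp only [cubeM]; omega) 1 one_pos
  have hD : ∀ R, 1 ≤ R → ∀ μ ν : Fin (d + 1),
      PosDecay (rho (cubeM d R)) (id ∘ blkBox hn (cubeM d R)) (id ∘ blkBox hn (cubeM d R))
          (shiftDiff μ ((((ℓ + 1) ^ k : ℕ)) : ℝ) (1 - projR ((ℓ + 1) ^ k) (cubeM d R))) (C * ((((ℓ + 1) ^ k : ℕ) : ℝ) ^ (d + 1))⁻¹) δ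
        ∧ PosDecay (rho (cubeM d R)) (id ∘ blkBox hn (cubeM d R)) (id ∘ blkBox hn (cubeM d R))
          (shiftDiffCol ν ((((ℓ + 1) ^ k : ℕ)) : ℝ) (1 - projR ((ℓ + 1) ^ k) (cubeM d R))) (C * ((((ℓ + 1) ^ k : ℕ) : ℝ) ^ (d + 1))⁻¹) δ
        ∧ PosDecay (rho (cubeM d R)) (id ∘ blkBox hn (cubeM d R)) (id ∘ blkBox hn (cubeM d R))
          (shiftDiff μ ((((ℓ + 1) ^ k : ℕ)) : ℝ) (shiftDiffCol ν ((((ℓ + 1) ^ k : ℕ)) : ℝ) (1 - projR ((ℓ + 1) ^ k) (cubeM d R))))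
          (C * ((((ℓ + 1) ^ k : ℕ) : ℝ) ^ (d + 1))⁻¹) δ := by
    intro R hR μ' ν'
    obtain ⟨h1, -, h3, h4⟩ := h k hk (cubeM d R) (fun i => by simp only [cubeM]; omega) μ' ν'
    exact ⟨h1, h3, h4⟩
  have hmain := Pz_deriv_of_box hn hδ₀.le hbox hD μ ν x x'
  rw [quo_eq_blk, quo_eq_blk]
  exact hmain

/-! ## §3 Non-vacuity: the physical case `d + 1 = 4`, `L = 2` -/

/-- `Pz_deriv_decay_uniform` at `d + 1 = 4`, `L = 2` (prefix inhabited: `k = 1`, `μ = ν = 0`, `x = x′ = 0`). -/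
example : ∃ δ C : ℝ, 0 < δ ∧ 0 < C ∧ ∀ (k : ℕ), 1 ≤ k → ∀ (μ ν : Fin (3 + 1)) (x x' : Fin (3 + 1) → ℤ),
      |((((1 + 1) ^ k : ℕ)) : ℝ) * (@Pz 3 ((1 + 1) ^ k) ⟨Nat.pos_iff_ne_zero.1 (Nat.one_le_pow k (1 + 1) (Nat.succ_pos 1))⟩ (x + Pi.single μ 1) x'
          - @Pz 3 ((1 + 1) ^ k) ⟨Nat.pos_iff_ne_zero.1 (Nat.one_le_pow k (1 + 1) (Nat.succ_pos 1))⟩ x x')|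
        ≤ C * ((((1 + 1) ^ k : ℕ) : ℝ) ^ (3 + 1))⁻¹ * Real.exp (-(δ * supNorm (quo ((1 + 1) ^ k) x - quo ((1 + 1) ^ k) x')))
      ∧ |((((1 + 1) ^ k : ℕ)) : ℝ) * (@Pz 3 ((1 + 1) ^ k) ⟨Nat.pos_iff_ne_zero.1 (Nat.one_le_pow k (1 + 1) (Nat.succ_pos 1))⟩ x (x' + Pi.single ν 1)
          - @Pz 3 ((1 + 1) ^ k) ⟨Nat.pos_iff_ne_zero.1 (Nat.one_le_pow k (1 + 1) (Nat.succ_pos 1))⟩ x x')|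
        ≤ C * ((((1 + 1) ^ k : ℕ) : ℝ) ^ (3 + 1))⁻¹ * Real.exp (-(δ * supNorm (quo ((1 + 1) ^ k) x - quo ((1 + 1) ^ k) x')))
      ∧ |((((1 + 1) ^ k : ℕ)) : ℝ) * ((((1 + 1) ^ k : ℕ)) : ℝ)
          * (@Pz 3 ((1 + 1) ^ k) ⟨Nat.pos_iff_ne_zero.1 (Nat.one_le_pow k (1 + 1) (Nat.succ_pos 1))⟩ (x + Pi.single μ 1) (x' + Pi.single ν 1)
            - @Pz 3 ((1 + 1) ^ k) ⟨Nat.pos_iff_ne_zero.1 (Nat.one_le_pow k (1 + 1) (Nat.succ_pos 1))⟩ (x + Pi.single μ 1) x'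
            - @Pz 3 ((1 + 1) ^ k) ⟨Nat.pos_iff_ne_zero.1 (Nat.one_le_pow k (1 + 1) (Nat.succ_pos 1))⟩ x (x' + Pi.single ν 1)
            + @Pz 3 ((1 + 1) ^ k) ⟨Nat.pos_iff_ne_zero.1 (Nat.one_le_pow k (1 + 1) (Nat.succ_pos 1))⟩ x x')|
        ≤ C * ((((1 + 1) ^ k : ℕ) : ℝ) ^ (3 + 1))⁻¹ * Real.exp (-(δ * supNorm (quo ((1 + 1) ^ k) x - quo ((1 + 1) ^ k) x'))) :=
  Pz_deriv_decay_uniform 3 1 le_rfl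

end

end Summit.QuantumFields.BalabanUV.Beta.GAN24.WoodburyFibreProjectorDerivZd
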